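import Summits.BirchSwinnertonDyer.BirchSwinnertonDyer.Theorems.WildThreeRankOneBSDpOfGlobalDivisibility
import HarnessLib

/-!
# RUNG J_max@3 in Manin-robust currency: (§1) the ONE new local lemma of the port of Jetchev 2008 to the
# additive prime `3` — STRINGENCY of a Kummer class at ANY place (incl. `v ∣ p`) by unramified descent,
# kernel-checked at its algebraic core; (§2) the SINGLE-CARRIER JET sub-leaf class theorem: Jetchev's
# Thm. 1.4 READ at `p = 3 ∣ N` (max-form global divisibility, displayed) + McCallum + the rank-zero wild leaf
# ⟹ `BSD₃(E)` (route-free; cell `bsd-wall`, D-0131 (3) M-UTD, seat `bsd-wall-utd-p3` gen 3;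
# `--supports stmt-BirchSwinnertonDyer-20760` = SOED crux J `WildSigmaDivisibilityAtThree`)

Companions: gen 0 `WildThreeRankOneBSDpOfHeegnerIndexCoprime.lean` (COPRIME sub-leaf: Kolyvagin's printed
bound alone), gen 1 `WildThreeRankOneBSDpOfGlobalDivisibility.lean` (JET-PRODUCT sub-leaf ⟸ Σ-form global
divisibility = crux J, research), steward memo `HOME/bsd-wall-pss3/TRANSFER-JETCHEV-AT3-v1.md` (port table
S1–S7 of Jetchev, Compos. Math. 144 (2008) = arXiv:math/0703431: only S3 needs a new lemma at `v ∣ p`; S7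
max → Σ does not transfer). ROUTE-FREE (imports no `Theses.*`).

## §1 The stringency lemma (replaces Jetchev's Prop. 4.9 / Lemma 4.3, which use `p`-divisibility of
## `E⁰(K_v^ur)` — false at `v ∣ p`)

Setting of Prop. 4.9 [arXiv:math/0703431 p. 13]: a place `v` of `K` above a Tamagawa prime `q ∣ N`, an
unramified extension `L_w = K[c]_w ⊇ K_v`, a class `κ = κ_{c,m} ∈ H¹(K_v, E[p^m])` with (a) `κ = δ_v(Q)` for
some `Q ∈ E(K_v)` (the classical Kummer condition at `v ∣ N`: Gross 1991 Prop. 6.2(1) / McCallum / Howard,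
"known", first sentence of the printed proof) and (b) `res_w κ = δ_w(P_c)` with `P_c ∈ E⁰(L_w)` up to a
rational prime-to-`p` torsion point (Jetchev Cor. 3.2 = Gross–Zagier: the Heegner divisor lies in `J⁰` up
to the cuspidal class). Kummer theory over `L_w` turns (a)+(b) into `Q − P = p^m·R` with `R ∈ E(L_w)`,
`P ∈ E⁰(L_w)`. THE LEMMA (`exists_sub_smul_mem_of_sub_eq_smul`): if the component group
`Φ_w = E(L_w)/E⁰(L_w)` has `p`-exponent `≤ m` — i.e. every class is killed by `p^m·N` for some `N` prime to
`p` (the displayed hypothesis `hΦ`); automatic once `m ≥ v_p #Φ_v(k̄_v)`, and Jetchev's `m` is «sufficiently large» (§6.3: any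
`m > max{m₀, m_max}`) — then `Q′ := Q − p^m·(u·Q) ∈ E⁰(L_w)` for some `u ∈ ℤ`; since `Q′ ∈ E(K_v)` and
(minimal models are stable under unramified base change) `E(K_v) ∩ E⁰(L_w) = E⁰(K_v)`, and `δ_v` kills
`p^m E(K_v)`, we get `κ = δ_v(Q′) ∈ δ_v(E⁰(K_v)) = H¹_{Kum⁰}(K_v, E[p^m])` — the STRINGENT condition —
with NO `p`-divisibility of `E⁰` and NO Lang's theorem (`stringent_of_unramifiedDescent`, abstract Kummer map;
`pExponentLE_of_card` supplies the hypothesis from `v_p #Φ_w ≤ m`). So step S3 of the port transfers at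
EVERY place, `v ∣ 3` with Kodaira type IV/IV* (`Φ = ℤ/3`, `c₃ = 3`) included. Pure algebra here; the
arithmetic identifications (a), (b), `E(K_v) ∩ E⁰(L_w) = E⁰(K_v)` are the port's bookkeeping (memo
HOME/bsd-wall-utd-p3/JMAX-AT3-PORT-v1.md).

## §2 The SINGLE-CARRIER JET sub-leaf (census: the `JET@p∣N` register rows with ONE 3-Tamagawa prime)

`bsdp_three_of_singleCarrier_of_jetchevMax_of_wAllExclAddWildRankZero`: for `E` on `ClassO6 W 3` with
`r_an = 1`, `ρ_{E,3^n}` onto for all `n`, ONE Heegner datum with odd `d_K`, `L(E^{d_K},1) ≠ 0` and JET-exact index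
`ord₃[E(K):ℤP] = ord₃ ∏_ℓ c_ℓ(E) + v₃(c)`, whose whole `3`-part of `c(Dt)·∏_ℓ c_ℓ(E)` is carried by ONE prime
`q₀ ∣ N` (`ord₃ ∏_ℓ c_ℓ + v₃(c) ≤ ord₃ c_{q₀}`: single carrier, `3 ∤ c`): Jetchev's Thm. 1.4 READ at `3 ∣ N` in
the monotone max-form (`hJmax`, DISPLAYED: for every prime `q ∣ N`, every `s′ ≤ ord₃ c_q`, every Kolyvagin
datum of square-free conductor with primes of index `≥ s′`, `3^{s′} ∣ P_n` in `E(K[n])` — the statement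
rung J_max@3 proves under the tower; NOT in print at `p ∣ N`: Hypothesis (\*) of op. cit. is `p ∤ N`) +
McCallum Cor. 5.6 (named) + GZ/Kolyvagin/GZK/modularity/GZ86 (named) + the leaf `WAllExclAddWildRankZero`
(hypothesis) ⟹ `BSDp W 3`, by gen 1's §3 at depth `ord₃ ∏c + v₃(c) ≤ ord₃ c_{q₀}`. HONEST FRAMING: conditional on
the displayed input, the named facts and leaf #6; per datum; closes no item and no class by itself;
«beyond-print theorem»: NO. What it changes: on the single-carrier rows the research input J (Σ-form,
Büyükboduk 2009 §4.2 Q1 OPEN) is replaced by J_max@3 (Jetchev's own theorem shape, whose printed proof ports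
step by step — this file's §1 being the only new step — modulo the Kolyvagin–McCallum structure inputs).
BSD is not proved for any curve by this file. No definition, no named fact, no `sorry`.

References: [Jetchev2008] Thm. 1.4, Cor. 1.5, Cor. 3.2, Lemma 4.3, Def. 4.8, Prop. 4.9, Thm. 6.3, Prop. 6.4
(arXiv:math/0703431 pp. 3, 8, 9, 12–13, 15–17); [McCallumLMS1991] Cor. 5.6 (p. 310); [GrossLMS1991]
Prop. 6.2 (p. 222); [Bueyuekboduk2009] §4.2 Q1 (arXiv:0710.3858 p. 12).
-/

noncomputable section

open scoped Classical

set_option linter.dupNamespace false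
set_option autoImplicit false

/-! ### §1 Stringency by unramified descent (pure algebra) -/

namespace Summit.BirchSwinnertonDyer.BirchSwinnertonDyer.Theorems.JetchevStringency

/-- **A finite quotient of order `c` with `v_p(c) ≤ m` has `p`-exponent `≤ m`**: `c·x = 0` and
`c = p^{v_p c}·N` with `N = c / p^{v_p c}` prime to `p`, so `p^m·N·x = p^{m − v_p c}·c·x = 0`. (For the port:
`c = c_w = #Φ_w(k_w)`, and `m ≥ v_p #Φ(k̄_v)` is free since Jetchev's `m` is any sufficiently large integer.)
[cite: Jetchev2008, §6.3 proof of Thm. 1.4 («Fix an integer m > max{m₀, m_max}», arXiv:math/0703431 p. 17)] -/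
theorem pExponentLE_of_card {A : Type*} [AddCommGroup A] (A0 : AddSubgroup A) {p : ℕ} (hp : p.Prime) {m : ℕ}
    [Finite (A ⧸ A0)] (hm : padicValNat p (Nat.card (A ⧸ A0)) ≤ m) :
    ∀ x : A ⧸ A0, ∃ N : ℕ, p.Coprime N ∧ (p ^ m * N) • x = 0 := by
  intro x
  set c := Nat.card (A ⧸ A0) with hc
  have hc0 : c ≠ 0 := Nat.card_pos.ne'
  refine ⟨c / p ^ padicValNat p c, ?_, ?_⟩
  · rw [← Nat.factorization_def c hp]
    exact Nat.coprime_ordCompl hp hc0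
  · obtain ⟨k, hk⟩ := Nat.exists_eq_add_of_le hm
    have hx : c • x = 0 := addOrderOf_dvd_iff_nsmul_eq_zero.mp (addOrderOf_dvd_natCard x)
    have hmul : p ^ m * (c / p ^ padicValNat p c) = p ^ k * c := by
      rw [hk, pow_add, mul_comm (p ^ padicValNat p c) (p ^ k), mul_assoc,
        Nat.mul_div_cancel' pow_padicValNat_dvd]
    rw [hmul, mul_smul, hx, smul_zero]

/-- **Stringency by unramified descent, algebraic core.** In an abelian group `A` (`E(L_w)`) with a subgroup
`A⁰` (`E⁰(L_w)`) whose quotient has `p`-exponent `≤ m`: if `Q − P = p^m·R` with `P ∈ A⁰` (`Q ∈ E(K_v)` a Kummer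
representative of the class at `v`, `P = P_c − (torsion) ∈ E⁰(L_w)` by Gross–Zagier, `R` from Kummer theory over
`L_w`), then `Q − p^m·(u·Q) ∈ A⁰` for some `u ∈ ℤ`. Proof: in `A/A⁰`, `[Q] = p^m[R]` is killed by some `N`
prime to `p`; Bézout `a·p^m + b·N = 1` gives `(1 − a p^m)[Q] = bN[Q] = 0`. No `p`-divisibility of `A⁰`, no
Lang's theorem. [cite: Jetchev2008, Prop. 4.9 (arXiv:math/0703431 pp. 12–13) — the statement ported; Lemma 4.3 (p. 9) — the step replaced] -/
theorem exists_sub_smul_mem_of_sub_eq_smul {A : Type*} [AddCommGroup A] (A0 : AddSubgroup A) {p m : ℕ}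
    (hΦ : ∀ x : A ⧸ A0, ∃ N : ℕ, p.Coprime N ∧ (p ^ m * N) • x = 0)
    {Q P R : A} (hP : P ∈ A0) (hQPR : Q - P = (p ^ m) • R) :
    ∃ u : ℤ, Q - (p ^ m : ℕ) • (u • Q) ∈ A0 := by
  obtain ⟨N, hcop, hN⟩ := hΦ (R : A ⧸ A0)
  -- Bézout: `a·p^m + b·N = 1`
  obtain ⟨a, b, hab⟩ : IsCoprime ((p ^ m : ℕ) : ℤ) (N : ℤ) :=
    Nat.isCoprime_iff_coprime.mpr (Nat.Coprime.pow_left m hcop)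
  refine ⟨a, ?_⟩
  -- `[Q] = p^m • [R]` in `A/A⁰`
  have hP0 : (P : A ⧸ A0) = 0 := (QuotientAddGroup.eq_zero_iff P).mpr hP
  have hQ : (Q : A ⧸ A0) = (p ^ m) • (R : A ⧸ A0) := by
    have h2 : ((Q - P : A) : A ⧸ A0) = (((p ^ m) • R : A) : A ⧸ A0) := by rw [hQPR]
    rwa [QuotientAddGroup.mk_sub, hP0, sub_zero, QuotientAddGroup.mk_nsmul] at h2
  -- `N • [Q] = 0`
  have hNQ : (N : ℤ) • (Q : A ⧸ A0) = 0 := by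
    rw [natCast_zsmul, hQ, ← mul_smul, mul_comm, hN]
  -- `Q − p^m·(a·Q) = (b N)·Q`
  have hcoef : (1 : ℤ) - ((p ^ m : ℕ) : ℤ) * a = b * (N : ℤ) := by linear_combination -hab
  have key : Q - (p ^ m : ℕ) • (a • Q) = b • ((N : ℤ) • Q) := by
    calc Q - (p ^ m : ℕ) • (a • Q) = (1 : ℤ) • Q - (((p ^ m : ℕ) : ℤ) * a) • Q := by
            rw [one_smul, ← smul_smul, natCast_zsmul]
      _ = ((1 : ℤ) - ((p ^ m : ℕ) : ℤ) * a) • Q := (sub_smul _ _ _).symm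
      _ = (b * (N : ℤ)) • Q := by rw [hcoef]
      _ = b • ((N : ℤ) • Q) := mul_smul _ _ _
  rw [← QuotientAddGroup.eq_zero_iff, key, QuotientAddGroup.mk_zsmul, QuotientAddGroup.mk_zsmul, hNQ,
    smul_zero]

/-- **Stringency by unramified descent, Kummer form.** Data: `A` (`= E(L_w)`), subgroups `Av` (`= E(K_v)`) and
`A⁰` (`= E⁰(L_w)`; so `Av ⊓ A⁰ = E(K_v) ∩ E⁰(L_w) = E⁰(K_v)` for a minimal model stable under the unramified
extension `L_w/K_v`), an additive map `δ` on `Av` killing `p^m·Av` (the local Kummer map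
`E(K_v) → H¹(K_v, E[p^m])`), and the component bound («`p^m·Φ_w[p^∞] = 0`»: every class of `A/A⁰` killed by `p^m·N`, `N` prime to `p`). IF a class `δ(Q)`, `Q ∈ Av`,
becomes over `L_w` the Kummer class of a point of `A⁰` — read: `Q − P = p^m·R`, `P ∈ A⁰`, `R ∈ A` — THEN
`δ(Q) = δ(Q′)` for some `Q′ ∈ Av ⊓ A⁰`: the class is STRINGENT at `v` (`∈ δ_v(E⁰(K_v)) = H¹_{Kum⁰}`).
This is Jetchev's Prop. 4.9 with its proof's Lemma 4.3 (false at `v ∣ p`) replaced by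
`exists_sub_smul_mem_of_sub_eq_smul`; valid at EVERY place. [cite: Jetchev2008, Prop. 4.9 and Def. 4.8 (arXiv:math/0703431 pp. 12–13)] -/
theorem stringent_of_unramifiedDescent {A H : Type*} [AddCommGroup A] [AddCommGroup H]
    (Av A0 : AddSubgroup A) {p m : ℕ} (δ : Av →+ H) (hδ : ∀ S : Av, δ ((p ^ m : ℕ) • S) = 0)
    (hΦ : ∀ x : A ⧸ A0, ∃ N : ℕ, p.Coprime N ∧ (p ^ m * N) • x = 0)
    {Q : Av} {P R : A} (hP : P ∈ A0) (hQPR : (Q : A) - P = (p ^ m) • R) :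
    ∃ Q' : Av, (Q' : A) ∈ A0 ∧ δ Q' = δ Q := by
  obtain ⟨u, hu⟩ := exists_sub_smul_mem_of_sub_eq_smul A0 hΦ hP hQPR
  refine ⟨Q - (p ^ m : ℕ) • (u • Q), ?_, ?_⟩
  · simpa only [AddSubgroupClass.coe_sub, AddSubgroupClass.coe_nsmul, AddSubgroupClass.coe_zsmul] using hu
  · rw [map_sub, hδ, sub_zero]

end Summit.BirchSwinnertonDyer.BirchSwinnertonDyer.Theorems.JetchevStringency

/-! ### §2 The SINGLE-CARRIER JET sub-leaf from J_max@3 -/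

namespace Summit.BirchSwinnertonDyer.BirchSwinnertonDyer.Theorems.SchneiderFree.Exact

open WeierstrassCurve NumberField IsDedekindDomain Field
  Literature.NumberTheory.EllipticCurves
  Literature.NumberTheory.EllipticCurves.ModularForms
  Literature.NumberTheory.EllipticCurves.Rank1Residual
  Summit.BirchSwinnertonDyer.Rank1Residual
  Summit.BirchSwinnertonDyer.Rank1Residual.Additive
  Summit.BirchSwinnertonDyer.Rank1Residual.X11b
  Summit.BirchSwinnertonDyer.Rank1Residual.X11b.Three

/-- **Max-form ⟹ Σ-form on single-carrier data (arithmetic).** If the whole `p`-part of `c(Dt)·∏_ℓ c_ℓ(E)` is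
carried by ONE prime `q₀ ∣ N` (`ord_p ∏_ℓ c_ℓ + v_p(c) ≤ ord_p c_{q₀}`), then global divisibility to depth
`ord_p c_q` for every prime `q ∣ N` (Jetchev's Thm. 1.4 in monotone max-form, READ at the frame) gives it to
depth `ord_p ∏_ℓ c_ℓ + v_p(c)` (the Σ-form hypothesis of gen 1's receptacle / crux J at this datum). Pure logic.
[cite: Jetchev2008, Thm. 1.4 and Cor. 1.5 (arXiv:math/0703431 p. 3)] -/
theorem globalDivisibility_of_jetchevMax_of_singleCarrier
    {W : WeierstrassCurve ℚ} [W.IsElliptic] [W.IsGloballyMinimal] {K : Type} [Field K] [NumberField K]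
    [NeZero (W.conductorNorm ℤ)]
    {Dt : ModularParametrizationData W (W.conductorNorm ℤ)} {β : ℤ} {ι : K →+* ℂ} {p : ℕ}
    (hJmax : ∀ (q : ℕ) [Fact q.Prime], q ∣ W.conductorNorm ℤ →
      ∀ (s' : ℕ), s' ≤ padicValNat p ((W.baseChange ℚ_[q]).localTamagawaNumber ℤ_[q]) →
      ∀ (n : ℕ) (d : KolyvaginHeegnerData Dt β ι n), Squarefree n →
        (∀ ℓ ∈ n.primeFactors, Zhang2014.IsKolyvaginPrime (W.conductorNorm ℤ) W K p ℓ ∧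
          s' ≤ Zhang2014.kolyvaginIndex W p ℓ) → Koly.PDiv d p s')
    {q₀ : ℕ} [Fact q₀.Prime] (hq₀ : q₀ ∣ W.conductorNorm ℤ)
    (hcar : padicValNat p W.tamagawaProduct + padicValNat p Dt.c.natAbs ≤
      padicValNat p ((W.baseChange ℚ_[q₀]).localTamagawaNumber ℤ_[q₀])) :
    ∀ (s' : ℕ), s' ≤ padicValNat p W.tamagawaProduct + padicValNat p Dt.c.natAbs →
      ∀ (n : ℕ) (d : KolyvaginHeegnerData Dt β ι n), Squarefree n →
        (∀ ℓ ∈ n.primeFactors, Zhang2014.IsKolyvaginPrime (W.conductorNorm ℤ) W K p ℓ ∧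
          s' ≤ Zhang2014.kolyvaginIndex W p ℓ) → Koly.PDiv d p s' :=
  fun s' hs' n d hn hℓ ↦ hJmax q₀ hq₀ s' (hs'.trans hcar) n d hn hℓ

/-- **THE SINGLE-CARRIER JET SUB-LEAF of W-ALL row 2·3@3: J_max@3 + McCallum + the rank-zero wild leaf ⟹
`BSD₃(E)`.** For `E` (globally minimal `W`) on `ClassO6 W 3` with `r_an = 1`, `ρ_{E,3^n}` onto for every `n`, ONE
Heegner datum `(K, Dt, H, ι, P)` at level `N_E` — odd `d_K`, Heegner hypothesis, `L(E^{d_K},1) ≠ 0`, `P = y_K` —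
with JET-exact index `ord₃[E(K):ℤP] = ord₃ ∏_ℓ c_ℓ(E) + v₃(c)` (`hI`, census `i3 = t3`) and a SINGLE CARRIER
`q₀ ∣ N_E` of the `3`-part of `c·∏_ℓ c_ℓ` (`hcar`; e.g. `q₀ = 3` with Kodaira type IV/IV*, `c₃ = 3`, all other
`c_ℓ` and `c` prime to `3`): Jetchev's Thm. 1.4 at `3 ∣ N` in monotone max-form (`hJmax`, DISPLAYED — rung
J_max@3, whose port needs only §1's lemma beyond print, modulo the Kolyvagin–McCallum structure inputs),
McCallum 1991 Cor. 5.6 upper form (`hMcU`, named), Gross–Zagier / Kolyvagin / GZK / modularity / GZ86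
I.(7.3) (named) and the leaf `WAllExclAddWildRankZero` (hypothesis) give `BSDp W 3` — gen 1's
`bsdp_three_of_indexEqTamagawaManin_of_globalDivisibility_of_wAllExclAddWildRankZero` at this datum. NO main
conjecture, NO `p`-adic `L`-function, NO control theorem, NO twin. CONDITIONAL; per datum; closes nothing by itself.
[cite: Jetchev2008, Thm. 1.4, Cor. 1.5 (arXiv:math/0703431 p. 3)] [cite: McCallumLMS1991, §5 Cor. 5.6 (p. 310)]
[cite: JetchevSkinnerWan2017, §7.4.1 (arXiv:1512.06894 p. 30)] [cite: GrossZagier1986, Thm. I.(6.3) and V.§2] -/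
theorem bsdp_three_of_singleCarrier_of_jetchevMax_of_wAllExclAddWildRankZero
    (hGZ : ∀ (N : ℕ) [NeZero N] (W : WeierstrassCurve ℚ) (K : Type) [Field K] [NumberField K],
      gross_zagier N W K)
    (hKo : ∀ (N : ℕ) [NeZero N] (W : WeierstrassCurve ℚ) (K : Type) [Field K] [NumberField K],
      kolyvagin N W K)
    (hGZK : rank_eq_analyticRank_of_analyticRank_le_one) (hmod : hasEntireLFunction_rat)
    (hGZ73 : GrossZagier1986_thm_I_7_3)
    (hMcU : McCallum1991_padicValNat_card_sha_primary_add_le_of_globalDivisibility)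
    (hRZ : Summit.BirchSwinnertonDyer.WAllExclAddWildRankZero)
    (W : WeierstrassCurve ℚ) [W.IsElliptic] [W.IsGloballyMinimal] [NeZero (W.conductorNorm ℤ)]
    (hO6 : ClassO6 W 3) (hρ : ∀ n : ℕ, W.HasSurjectiveModNGaloisRep (3 ^ n : ℕ)) (hr : W.analyticRank = 1)
    (K : Type) [Field K] [NumberField K]
    (Dt : ModularParametrizationData W (W.conductorNorm ℤ))
    (H : HeegnerDatum (W.conductorNorm ℤ) (NumberField.discr K)) (ι : K →+* ℂ)
    (P : (W.baseChange K).toAffine.Point)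
    (hK : IsImaginaryQuadratic K) (hodd : Odd (NumberField.discr K))
    (hHH : SatisfiesHeegnerHypothesis (W.conductorNorm ℤ) K)
    (hLd : (W.quadraticTwist (NumberField.discr K : ℚ)).entireLFunction 1 ≠ 0)
    (hP : WeierstrassCurve.Affine.Point.map ι.toRatAlgHom P = heegnerPointComplex Dt H)
    (hI : padicValNat 3 (AddSubgroup.zmultiples P).index =
      padicValNat 3 W.tamagawaProduct + padicValNat 3 Dt.c.natAbs)
    {q₀ : ℕ} [Fact q₀.Prime] (hq₀ : q₀ ∣ W.conductorNorm ℤ)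
    (hcar : padicValNat 3 W.tamagawaProduct + padicValNat 3 Dt.c.natAbs ≤
      padicValNat 3 ((W.baseChange ℚ_[q₀]).localTamagawaNumber ℤ_[q₀]))
    (hJmax : ∀ (q : ℕ) [Fact q.Prime], q ∣ W.conductorNorm ℤ →
      ∀ (s' : ℕ), s' ≤ padicValNat 3 ((W.baseChange ℚ_[q]).localTamagawaNumber ℤ_[q]) →
      ∀ (n : ℕ) (d : KolyvaginHeegnerData Dt H.β ι n), Squarefree n →
        (∀ ℓ ∈ n.primeFactors, Zhang2014.IsKolyvaginPrime (W.conductorNorm ℤ) W K 3 ℓ ∧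
          s' ≤ Zhang2014.kolyvaginIndex W 3 ℓ) → Koly.PDiv d 3 s') :
    BSDp W 3 :=
  bsdp_three_of_indexEqTamagawaManin_of_globalDivisibility_of_wAllExclAddWildRankZero hGZ hKo hGZK hmod hGZ73
    hMcU hRZ W hO6 hρ hr K Dt H ι P hK hodd hHH hLd hP hI
    (globalDivisibility_of_jetchevMax_of_singleCarrier hJmax hq₀ hcar)

end Summit.BirchSwinnertonDyer.BirchSwinnertonDyer.Theorems.SchneiderFree.Exact

end
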